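import Literature.MathematicalPhysics.QuantumFieldTheory.FiniteTemperatureTYTwistBound
import HarnessLib

/-!
# The Tomboulis–Yaffe inequality at FINITE TEMPERATURE: the temporal plaquette is bounded by the electric-flux
# (temporal-twist) free energy, on the Borgs–Seiler lattice `ℤ_{L_t} × (ℤ/L_s)^d` with `L_t ≠ L_s`

E. T. Tomboulis and L. G. Yaffe, Commun. Math. Phys. **100** (1985) 313–341, §II (2.8)–(2.10) and App. I (A1.9): on the periodic
lattice with `L_t` time slices and spatial side `L_s` (both powers of two), reflection positivity gives the chain of App. I and hence
the bound of Wilson loops by the electric-flux free energy `exp(-F^{el}/T) = ½(1 - Z⁻/Z)` — for the plaquette,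
`⟨W_{1×1}⟩ ≤ N^{…} (1 - Z⁻/Z)^{1/(L_s L_t)}`.  The tree's `TomboulisYaffeInequality.lean` proves this on the SYMMETRIC torus and records
"TODO(general form): asymmetric tori `L_t × L_s^{d-1}`".  This file ASSEMBLES the finite-temperature chain of
`FiniteTemperatureTYLoopBounds.lean` ((A1.3), (A1.6)–(A1.7), §B) and `FiniteTemperatureTYTwistBound.lean` ((A1.8)) into the inequality
in TY's native setting, for every compact `G`, continuous unitary `ρ`, central `z` with `ρ(z) = ω·1` (`|ω| = 1`), ANY real `J_E, J_M`,
temporal period `L_t = 2m + 2 = 2^{a+1}` and spatial period `L_s = 2n + 2 = 2^{b+1} ≥ 4`: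

* `pow_two_pow_le_of_sq_le` — the downward induction along a doubling chain (`e_j² ≤ K e_{j+1}` ⇒ `e_0^{2^a} ≤ K^{2^a-1} e_a`);
* `integral_polyakov_pair_conj_symm`, `integral_polyakov_pair_translate` — the Polyakov pair integral is Hermitian and
  translation invariant (plumbing over the tree's `FiniteTemperature.polyakovKernel_add`);
* ★★★ `normSq_plaquette_pow_le_one_sub_twist` — **the finite-temperature Tomboulis–Yaffe inequality, plaquette form**:
  `|1 - ω|² · (|⟨tr ρ(U_□)⟩| / N)^{L_t L_s} ≤ 8 N^{2 L_s} · (1 - Z⁻_z / Z)`,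
  where `U_□` is a `(time, i)` plaquette, `⟨·⟩` the finite-temperature expectation, and `Z⁻_z = ∫ T_{0,z} e^{-S}` the partition
  function with the stack of `(time, i)` plaquettes at `{t = 0, x_i = 0}` twisted by `z` ('t Hooft's temporal twist).  Read as a
  FLOOR on the vortex∕electric-flux deficit: `1 - Z⁻_z/Z ≥ |1 - ω|² |⟨tr ρ(U_□)⟩|^{L_tL_s} / (8 N^{L_tL_s + 2L_s})`, uniformly in the two
  periods — the input, on the anisotropic box, of strong-coupling vortex-ratio comparisons.

Everything is proved; no definitions.  HONEST FRAMING: a finite-volume inequality at fixed couplings; combined with a plaquette floor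
it bounds the temporal-twist deficit from below; nothing here is a statement about `β → ∞`, confinement in the continuum, or the
Yang–Mills mass gap.

References: E. T. Tomboulis, L. G. Yaffe, Commun. Math. Phys. 100 (1985) 313–341, §II (2.8)–(2.10), App. I (A1.3)–(A1.9)
[TomboulisYaffe1985]; T. Kanazawa, Ann. Phys. 324 (2009) 1634, §2 Thm 1–2 [Kanazawa2008]; C. Borgs, E. Seiler, Commun. Math. Phys. 91
(1983) 329, §II.3.
-/

noncomputable section

open MeasureTheory Filter Topology Finset
open scoped ComplexConjugate ComplexOrder BigOperators

namespace Literature.Barriers.QuantumFields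

namespace FiniteTemperature

open Literature.MathematicalPhysics.QuantumFieldTheory

/-! ### The doubling chain -/

/-- **Downward induction along a doubling chain**: if `0 ≤ e_j`, `e_j² ≤ K e_{j+1}` for `j < a` and `K ≥ 0`, then
`e_0^{2^a} ≤ K^{2^a - 1} e_a` (TY: "repeated application … then yields"). [cite: TomboulisYaffe1985, App. I (A1.3)–(A1.4), (A1.9)] -/
theorem pow_two_pow_le_of_sq_le {e : ℕ → ℝ} {K : ℝ} (hK : 0 ≤ K) (he : ∀ j, 0 ≤ e j) :
    ∀ {a : ℕ}, (∀ j < a, e j ^ 2 ≤ K * e (j + 1)) → e 0 ^ (2 ^ a) ≤ K ^ (2 ^ a - 1) * e a := by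
  intro a
  induction a with
  | zero => intro _; simp
  | succ a ih =>
    intro h
    have h1 : e 0 ^ (2 ^ a) ≤ K ^ (2 ^ a - 1) * e a := ih fun j hj => h j (by omega)
    have h2 : e a ^ 2 ≤ K * e (a + 1) := h a (by omega)
    have hpos : (1 : ℕ) ≤ 2 ^ a := Nat.one_le_two_pow
    calc e 0 ^ (2 ^ (a + 1)) = (e 0 ^ (2 ^ a)) ^ 2 := by rw [pow_succ, pow_mul]
      _ ≤ (K ^ (2 ^ a - 1) * e a) ^ 2 := pow_le_pow_left₀ (pow_nonneg (he 0) _) h1 2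
      _ = K ^ (2 * (2 ^ a - 1)) * e a ^ 2 := by rw [mul_pow, ← pow_mul, mul_comm (2 ^ a - 1) 2]
      _ ≤ K ^ (2 * (2 ^ a - 1)) * (K * e (a + 1)) := mul_le_mul_of_nonneg_left h2 (pow_nonneg hK _)
      _ = K ^ (2 ^ (a + 1) - 1) * e (a + 1) := by
        rw [← mul_assoc, ← pow_succ]
        congr 2
        rw [pow_succ]
        omega

/-- The exponent bookkeeping of the Tomboulis–Yaffe chain (pure algebra): from the four links
`p^A ≤ N^{A-1} e`, `e² ≤ N² κ₁`, `κ₁^B ≤ N^{2B-2} κ_B`, `w κ_B² ≤ 8 N⁴ (1 - r)` (`A, B ≥ 1`) to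
`w · p^{(2A)(2B)} ≤ 8 N^{(2A)(2B) + 2(2B)} (1 - r)`. [cite: TomboulisYaffe1985, App. I (A1.9), §II (2.10)] -/
theorem ty_chain_algebra {p e κ₁ κB r N w : ℝ} {A B : ℕ} (hN : 0 ≤ N) (hp : 0 ≤ p) (_he : 0 ≤ e) (hκ₁ : 0 ≤ κ₁)
    (hw : 0 ≤ w) (_hA : 1 ≤ A) (_hB : 1 ≤ B)
    (h1 : p ^ A ≤ N ^ (A - 1) * e) (h2 : e ^ 2 ≤ N ^ 2 * κ₁) (h3 : κ₁ ^ B ≤ N ^ (2 * B - 2) * κB)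
    (h4 : w * κB ^ 2 ≤ 8 * N ^ 4 * (1 - r)) :
    w * p ^ (2 * A * (2 * B)) ≤ 8 * N ^ (2 * A * (2 * B) + 2 * (2 * B)) * (1 - r) := by
  -- `p^{2A} ≤ N^{2A} κ₁`
  have s1 : p ^ (2 * A) ≤ N ^ (2 * A) * κ₁ := by
    calc p ^ (2 * A) = (p ^ A) ^ 2 := by rw [mul_comm, pow_mul]
      _ ≤ (N ^ (A - 1) * e) ^ 2 := pow_le_pow_left₀ (pow_nonneg hp _) h1 2
      _ = N ^ (2 * (A - 1)) * e ^ 2 := by rw [mul_pow, ← pow_mul, mul_comm (A - 1) 2]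
      _ ≤ N ^ (2 * (A - 1)) * (N ^ 2 * κ₁) := mul_le_mul_of_nonneg_left h2 (pow_nonneg hN _)
      _ = N ^ (2 * A) * κ₁ := by
        rw [← mul_assoc, ← pow_add]
        congr 2
        omega
  -- `κ₁^{2B} ≤ N^{4B-4} κB²`
  have s2 : κ₁ ^ (2 * B) ≤ N ^ (4 * B - 4) * κB ^ 2 := by
    calc κ₁ ^ (2 * B) = (κ₁ ^ B) ^ 2 := by rw [mul_comm, pow_mul]
      _ ≤ (N ^ (2 * B - 2) * κB) ^ 2 := pow_le_pow_left₀ (pow_nonneg hκ₁ _) h3 2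
      _ = N ^ (4 * B - 4) * κB ^ 2 := by
        rw [mul_pow, ← pow_mul]
        congr 2
        omega
  -- combine
  have s3 : p ^ (2 * A * (2 * B)) ≤ N ^ (2 * A * (2 * B)) * (N ^ (4 * B - 4) * κB ^ 2) := by
    calc p ^ (2 * A * (2 * B)) = (p ^ (2 * A)) ^ (2 * B) := by rw [pow_mul]
      _ ≤ (N ^ (2 * A) * κ₁) ^ (2 * B) := pow_le_pow_left₀ (pow_nonneg hp _) s1 _
      _ = N ^ (2 * A * (2 * B)) * κ₁ ^ (2 * B) := by rw [mul_pow, ← pow_mul]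
      _ ≤ N ^ (2 * A * (2 * B)) * (N ^ (4 * B - 4) * κB ^ 2) := mul_le_mul_of_nonneg_left s2 (pow_nonneg hN _)
  calc w * p ^ (2 * A * (2 * B)) ≤ w * (N ^ (2 * A * (2 * B)) * (N ^ (4 * B - 4) * κB ^ 2)) :=
        mul_le_mul_of_nonneg_left s3 hw
    _ = N ^ (2 * A * (2 * B)) * N ^ (4 * B - 4) * (w * κB ^ 2) := by ring
    _ ≤ N ^ (2 * A * (2 * B)) * N ^ (4 * B - 4) * (8 * N ^ 4 * (1 - r)) :=
        mul_le_mul_of_nonneg_left h4 (mul_nonneg (pow_nonneg hN _) (pow_nonneg hN _))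
    _ = 8 * N ^ (2 * A * (2 * B) + 2 * (2 * B)) * (1 - r) := by
        rw [show 2 * A * (2 * B) + 2 * (2 * B) = 2 * A * (2 * B) + (4 * B - 4) + 4 by omega, pow_add, pow_add]
        ring

/-! ### The Polyakov pair integral: Hermitian symmetry and translations -/

section Pair

variable {d L₀ L : ℕ} [NeZero L₀] [NeZero L] {G : Type*} [Group G] [TopologicalSpace G] [IsTopologicalGroup G]
  [CompactSpace G] [MeasurableSpace G] [BorelSpace G] [SecondCountableTopology G] {N : ℕ}
variable (ρ : G →* Matrix (Fin N) (Fin N) ℂ)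

omit [SecondCountableTopology G] in
/-- **Hermitian symmetry of the Polyakov pair integral**: `∫ tr P_y conj tr P_x e^{-S} = conj ∫ tr P_x conj tr P_y e^{-S}`.
[cite: BorgsSeiler1983, §II.3 (II.22) (p. 337)] -/
theorem integral_polyakov_pair_conj_symm (JE JM : ℝ) (x y : Fin d → ZMod L) :
    ∫ U, polyakovTrace ρ U y * conj (polyakovTrace ρ U x) * (weight ρ JE JM U : ℂ) ∂haar d L₀ L G =
      conj (∫ U, polyakovTrace ρ U x * conj (polyakovTrace ρ U y) * (weight ρ JE JM U : ℂ) ∂haar d L₀ L G) := by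
  rw [← integral_conj]
  refine integral_congr_ae (Eventually.of_forall fun U => ?_)
  simp only [map_mul, Complex.conj_conj, Complex.conj_ofReal]
  ring

/-- **Translation invariance of the Polyakov pair integral**: `∫ tr P_{x+a} conj tr P_{y+a} e^{-S} = ∫ tr P_x conj tr P_y e^{-S}`
(the tree's `FiniteTemperature.polyakovKernel_add`, un-normalised). [cite: BorgsSeiler1983, §II.3 (II.22) (p. 337)] -/
theorem integral_polyakov_pair_translate (hρ : Continuous ρ) (JE JM : ℝ) (x y a : Fin d → ZMod L) :
    ∫ U, polyakovTrace ρ U (x + a) * conj (polyakovTrace ρ U (y + a)) * (weight ρ JE JM U : ℂ) ∂haar d L₀ L G =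
      ∫ U, polyakovTrace ρ U x * conj (polyakovTrace ρ U y) * (weight ρ JE JM U : ℂ) ∂haar d L₀ L G := by
  have h := polyakovKernel_add (L₀ := L₀) ρ JE JM x y a
  unfold polyakovKernel at h
  have hZ : ((∫ U, weight ρ JE JM U ∂haar d L₀ L G : ℝ) : ℂ) ≠ 0 := by
    exact_mod_cast (partitionFunction_pos (d := d) (L₀ := L₀) (L := L) ρ hρ JE JM).ne'
  exact (div_left_inj' hZ).1 h

end Pair

/-! ### The assembled inequality -/

section Assembly

variable {d m n : ℕ} {G : Type*} [Group G] [TopologicalSpace G] [IsTopologicalGroup G]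
  [CompactSpace G] [MeasurableSpace G] [BorelSpace G] [SecondCountableTopology G] {N : ℕ}
variable (ρ : G →* Matrix (Fin N) (Fin N) ℂ)

omit [TopologicalSpace G] [IsTopologicalGroup G] [CompactSpace G] [MeasurableSpace G] [BorelSpace G]
  [SecondCountableTopology G] in
/-- The rectangle of height one is the plaquette: `W_{1×1} = U_□`. [cite: TomboulisYaffe1985, App. I (A1.1)] -/
theorem timeRect_one {L₀ L : ℕ} (U : Config d L₀ L G) (i : Fin d) (t : ZMod L₀) (x : Fin d → ZMod L) :
    timeRect U 1 i t x = plaquette U (t, x) none (some i) := by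
  have h1 : ∀ y : Site d L₀ L, timeHolonomy U 1 y = U (y, none) := fun y => mul_one _
  unfold timeRect timeStaple plaquette
  rw [h1, h1]
  simp [Site.shift]

/-- The un-normalised rectangle integral `∫ tr ρ(W_{h×1}) e^{-S}` (plumbing). [cite: TomboulisYaffe1985, App. I (A1.1)] -/
def rectIntegral (JE JM : ℝ) (i : Fin d) (x : Fin d → ZMod (2 * n + 2)) (h : ℕ) : ℂ :=
  ∫ U, (ρ (timeRect U h i 0 x)).trace * (weight ρ JE JM U : ℂ) ∂haar d (2 * m + 2) (2 * n + 2) G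

/-- The un-normalised Polyakov pair integral `∫ tr ρ(P_x) conj tr ρ(P_y) e^{-S}` (plumbing). [cite: BorgsSeiler1983, §II.3 (II.22) (p. 337)] -/
def pairIntegral (JE JM : ℝ) (x y : Fin d → ZMod (2 * n + 2)) : ℂ :=
  ∫ U, polyakovTrace ρ U x * conj (polyakovTrace ρ U y) * (weight ρ JE JM U : ℂ) ∂haar d (2 * m + 2) (2 * n + 2) G

/-- §B along the axis `i` from the origin, in terms of `pairIntegral`: for `1 ≤ s ≤ n + 1`,
`|∫ tr P_0 conj tr P_{-s e_i} e^{-S}|² ≤ N² Z · Re ∫ tr P_0 conj tr P_{-2s e_i} e^{-S}` (pair doubling, then a translation by `-s e_i`).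
[cite: TomboulisYaffe1985, App. I §B (p. 339)] -/
theorem normSq_pairIntegral_le (hρu : ∀ g, ρ g ∈ Matrix.unitaryGroup (Fin N) ℂ) (hρ : Continuous ρ) (hn1 : 1 ≤ n) (JE JM : ℝ)
    (i : Fin d) {s : ℕ} (hs1 : 1 ≤ s) (hs : s ≤ n + 1) :
    ‖pairIntegral (m := m) ρ JE JM 0 (0 - Pi.single i (s : ZMod (2 * n + 2)))‖ ^ 2 ≤
      (N : ℝ) ^ 2 * (∫ U, weight ρ JE JM U ∂haar d (2 * m + 2) (2 * n + 2) G) *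
        (pairIntegral (m := m) ρ JE JM 0 (0 - Pi.single i ((2 * s : ℕ) : ZMod (2 * n + 2)))).re := by
  have h := (normSq_integral_polyakov_pair_le (L₀ := 2 * m + 2) ρ hρu hρ hn1 JE JM i
    (x := (0 : Fin d → ZMod (2 * n + 2))) rfl hs1 hs).1
  have ht := integral_polyakov_pair_translate (L₀ := 2 * m + 2) ρ hρ JE JM
    ((0 : Fin d → ZMod (2 * n + 2)) + Pi.single i (s : ZMod (2 * n + 2))) (0 - Pi.single i (s : ZMod (2 * n + 2)))
    (0 - Pi.single i (s : ZMod (2 * n + 2)))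
  have e1 : (0 : Fin d → ZMod (2 * n + 2)) + Pi.single i (s : ZMod (2 * n + 2)) + (0 - Pi.single i (s : ZMod (2 * n + 2))) = 0 := by
    abel
  have e2 : (0 : Fin d → ZMod (2 * n + 2)) - Pi.single i (s : ZMod (2 * n + 2)) + (0 - Pi.single i (s : ZMod (2 * n + 2))) =
      0 - Pi.single i ((2 * s : ℕ) : ZMod (2 * n + 2)) := by
    simp only [zero_sub, ← Pi.single_neg, ← Pi.single_add]
    congr 1
    push_cast; ring
  rw [e1, e2] at ht
  unfold pairIntegral
  rw [ht]
  exact h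

/-- (A1.6)'s pair `(x, x + e_i)` read at the origin: `Re ∫ tr P_0 conj tr P_{-e_i} e^{-S} = Re ∫ tr P_x conj tr P_{x+e_i} e^{-S}`
(translation by `x + e_i` and Hermitian symmetry). [cite: BorgsSeiler1983, §II.3 (II.22) (p. 337)] -/
theorem pairIntegral_one_re (hρ : Continuous ρ) (JE JM : ℝ) (i : Fin d) (x : Fin d → ZMod (2 * n + 2)) :
    (pairIntegral (m := m) ρ JE JM 0 (0 - Pi.single i ((1 : ℕ) : ZMod (2 * n + 2)))).re =
      (pairIntegral (m := m) ρ JE JM x (x + Pi.single i 1)).re := by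
  have ht := integral_polyakov_pair_translate (L₀ := 2 * m + 2) ρ hρ JE JM (0 : Fin d → ZMod (2 * n + 2))
    (0 - Pi.single i (((1 : ℕ)) : ZMod (2 * n + 2))) (x + Pi.single i 1)
  have e1 : (0 : Fin d → ZMod (2 * n + 2)) + (x + Pi.single i 1) = x + Pi.single i 1 := zero_add _
  have e2 : (0 - Pi.single i (((1 : ℕ)) : ZMod (2 * n + 2))) + (x + Pi.single i 1) = x := by
    rw [Nat.cast_one]; abel
  rw [e1, e2] at ht
  unfold pairIntegral
  rw [← ht, integral_polyakov_pair_conj_symm ρ JE JM, Complex.conj_re]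

/-- **★★★ The Tomboulis–Yaffe inequality at finite temperature (plaquette form).**  On Borgs–Seiler's lattice `ℤ_{L_t} × (ℤ/L_s)^d`
with `L_t = 2m + 2 = 2^{a+1}` and `L_s = 2n + 2 = 2^{b+1} ≥ 4`, for a continuous unitary `ρ : G →* U(N)`, a central `z` with
`ρ(z) = ω·1`, `|ω| = 1`, ANY real `J_E, J_M`, a spatial direction `i` and a site `x`:
`|1 - ω|² · (|∫ tr ρ(U_□) e^{-S}| / Z)^{L_t L_s} ≤ 8 N^{L_tL_s + 2L_s} · (1 - Z⁻_z/Z)`,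
where `U_□` is the `(time, i)` plaquette at `(0, x)`, `Z = ∫ e^{-S}`, and `Z⁻_z = ∫ T_{0,z} e^{-S}` is the partition function with the
stack `{t = 0, x_i = 0}` of `(time, i)` plaquettes twisted by `z`.  Chain: time doubling (A1.3) from the plaquette to the rectangle of
height `L_t/2`; (A1.6)–(A1.7) to the adjacent Polyakov pair; §B spatial doubling to separation `L_s/2`; (A1.8).  (TY (2.10)∕(A1.9) with
`h = w = 1`; for `SU(2)`, `ω = -1`, `exp(-F^{el}/T) = ½(1 - Z⁻/Z)`.)
[cite: TomboulisYaffe1985, §II eq. (2.10) and App. I eq. (A1.9) (pp. 316, 339)] [cite: Kanazawa2008, §2 Thm 1–2] -/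
theorem normSq_plaquette_pow_le_one_sub_twist (hρu : ∀ g, ρ g ∈ Matrix.unitaryGroup (Fin N) ℂ) (hρ : Continuous ρ)
    (JE JM : ℝ) (i : Fin d) {z : G} (hz : z ∈ Subgroup.center G) {ω : ℂ} (hω : ρ z = ω • (1 : Matrix (Fin N) (Fin N) ℂ))
    (hω1 : ‖ω‖ = 1) {a b : ℕ} (hm : m + 1 = 2 ^ a) (hn : n + 1 = 2 ^ b) (hn1 : 1 ≤ n) (x : Fin d → ZMod (2 * n + 2)) :
    ‖1 - ω‖ ^ 2 * (‖∫ U, (ρ (plaquette U (0, x) none (some i))).trace * (weight ρ JE JM U : ℂ) ∂haar d (2 * m + 2) (2 * n + 2) G‖ /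
        ∫ U, weight ρ JE JM U ∂haar d (2 * m + 2) (2 * n + 2) G) ^ ((2 * m + 2) * (2 * n + 2)) ≤
      8 * (N : ℝ) ^ ((2 * m + 2) * (2 * n + 2) + 2 * (2 * n + 2)) *
        (1 - (∫ U, stackTwistObs ρ JE z i 0 U * weight ρ JE JM U ∂haar d (2 * m + 2) (2 * n + 2) G) /
          ∫ U, weight ρ JE JM U ∂haar d (2 * m + 2) (2 * n + 2) G) := by
  have hZ : 0 < ∫ U, weight ρ JE JM U ∂haar d (2 * m + 2) (2 * n + 2) G := partitionFunction_pos ρ hρ JE JM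
  set Z : ℝ := ∫ U, weight ρ JE JM U ∂haar d (2 * m + 2) (2 * n + 2) G with hZdef
  set R : ℝ := ∫ U, stackTwistObs ρ JE z i 0 U * weight ρ JE JM U ∂haar d (2 * m + 2) (2 * n + 2) G with hRdef
  -- the time-doubling chain `c j = ∫ tr W_{2^j × 1} e^{-S}`
  have hc0 : rectIntegral (m := m) ρ JE JM i x (2 ^ 0) =
      ∫ U, (ρ (plaquette U (0, x) none (some i))).trace * (weight ρ JE JM U : ℂ) ∂haar d (2 * m + 2) (2 * n + 2) G := by
    unfold rectIntegral
    refine integral_congr_ae (Eventually.of_forall fun U => ?_)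
    dsimp only
    rw [pow_zero, timeRect_one]
  set e₁ : ℕ → ℝ := fun j => ‖rectIntegral (m := m) ρ JE JM i x (2 ^ j)‖ / Z with he₁
  have hstepA : ∀ j < a, e₁ j ^ 2 ≤ N * e₁ (j + 1) := by
    intro j hj
    have hh : 2 ^ j ≤ m + 1 := by
      rw [hm]; exact Nat.pow_le_pow_right (by norm_num) hj.le
    have h := normSq_integral_trace_timeRect_le (m := m) (L := 2 * n + 2) ρ hρu hρ JE JM i x hh
    rw [show 2 * 2 ^ j = 2 ^ (j + 1) by rw [pow_succ]; ring] at h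
    simp only [he₁]
    rw [div_pow, div_le_iff₀ (pow_pos hZ 2)]
    calc ‖rectIntegral (m := m) ρ JE JM i x (2 ^ j)‖ ^ 2 ≤ N * Z * (rectIntegral (m := m) ρ JE JM i x (2 ^ (j + 1))).re := h
      _ ≤ N * Z * ‖rectIntegral (m := m) ρ JE JM i x (2 ^ (j + 1))‖ :=
          mul_le_mul_of_nonneg_left (Complex.re_le_norm _) (mul_nonneg (Nat.cast_nonneg _) hZ.le)
      _ = N * (‖rectIntegral (m := m) ρ JE JM i x (2 ^ (j + 1))‖ / Z) * Z ^ 2 := by field_simp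
  have h1' := pow_two_pow_le_of_sq_le (e := e₁) (Nat.cast_nonneg N)
    (fun j => by simp only [he₁]; exact div_nonneg (norm_nonneg _) hZ.le) hstepA
  have h1 : (‖rectIntegral (m := m) ρ JE JM i x (2 ^ 0)‖ / Z) ^ (2 ^ a) ≤
      (N : ℝ) ^ (2 ^ a - 1) * (‖rectIntegral (m := m) ρ JE JM i x (2 ^ a)‖ / Z) := by
    simp only [he₁] at h1'; exact h1'
  -- (A1.6): the rectangle of height `L_t/2 = 2^a` against the adjacent pair
  have hB : ‖rectIntegral (m := m) ρ JE JM i x (2 ^ a)‖ ^ 2 ≤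
      (N : ℝ) ^ 2 * Z * (pairIntegral (m := m) ρ JE JM x (x + Pi.single i 1)).re := by
    have h := normSq_integral_trace_timeRect_half_le (m := m) (L := 2 * n + 2) ρ hρu hρ JE JM i x
    rw [hm] at h
    exact h
  -- the spatial pair chain `k s = ∫ tr P_0 conj tr P_{-s e_i} e^{-S}`
  have hk1re := pairIntegral_one_re (m := m) ρ hρ JE JM i x
  set e₂ : ℕ → ℝ := fun j => ‖pairIntegral (m := m) ρ JE JM 0 (0 - Pi.single i (((2 ^ j : ℕ)) : ZMod (2 * n + 2)))‖ / Z
    with he₂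
  have hstepD : ∀ j < b, e₂ j ^ 2 ≤ (N : ℝ) ^ 2 * e₂ (j + 1) := by
    intro j hj
    have hs : 2 ^ j ≤ n + 1 := by rw [hn]; exact Nat.pow_le_pow_right (by norm_num) hj.le
    have h := normSq_pairIntegral_le (m := m) ρ hρu hρ hn1 JE JM i (s := 2 ^ j) Nat.one_le_two_pow hs
    rw [show 2 * 2 ^ j = 2 ^ (j + 1) by rw [pow_succ]; ring] at h
    simp only [he₂]
    rw [div_pow, div_le_iff₀ (pow_pos hZ 2)]
    refine h.trans ?_
    rw [show (N : ℝ) ^ 2 * (‖pairIntegral (m := m) ρ JE JM 0 (0 - Pi.single i (((2 ^ (j + 1) : ℕ)) : ZMod (2 * n + 2)))‖ / Z) * Z ^ 2 =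
      (N : ℝ) ^ 2 * Z * ‖pairIntegral (m := m) ρ JE JM 0 (0 - Pi.single i (((2 ^ (j + 1) : ℕ)) : ZMod (2 * n + 2)))‖ by
        field_simp]
    exact mul_le_mul_of_nonneg_left (Complex.re_le_norm _) (mul_nonneg (pow_nonneg (Nat.cast_nonneg _) _) hZ.le)
  have h3' := pow_two_pow_le_of_sq_le (e := e₂) (pow_nonneg (Nat.cast_nonneg N) 2)
    (fun j => by simp only [he₂]; exact div_nonneg (norm_nonneg _) hZ.le) hstepD
  -- (A1.8) at separation `L_s/2 = 2^b = n + 1`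
  have hx₁ : ((0 : Fin d → ZMod (2 * n + 2)) - (Pi.single i (((2 ^ b : ℕ)) : ZMod (2 * n + 2)) : Fin d → ZMod (2 * n + 2))) i =
      ((n + 1 : ℕ) : ZMod (2 * n + 2)) := by
    rw [← hn, Pi.sub_apply, Pi.zero_apply, Pi.single_eq_same, zero_sub, neg_half]
  have h4 := normSq_integral_polyakov_pair_le_twist (L₀ := 2 * m + 2) ρ hρu hρ hn1 JE JM i hz hω hω1
    (x₀ := (0 : Fin d → ZMod (2 * n + 2))) rfl hx₁
  -- normalise and combine
  have h2 : (‖rectIntegral (m := m) ρ JE JM i x (2 ^ a)‖ / Z) ^ 2 ≤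
      (N : ℝ) ^ 2 * (‖pairIntegral (m := m) ρ JE JM 0 (0 - Pi.single i (((2 ^ 0 : ℕ)) : ZMod (2 * n + 2)))‖ / Z) := by
    rw [pow_zero, div_pow, div_le_iff₀ (pow_pos hZ 2)]
    refine hB.trans ?_
    rw [← hk1re, show (N : ℝ) ^ 2 * (‖pairIntegral (m := m) ρ JE JM 0 (0 - Pi.single i (((1 : ℕ)) : ZMod (2 * n + 2)))‖ / Z) * Z ^ 2 =
      (N : ℝ) ^ 2 * Z * ‖pairIntegral (m := m) ρ JE JM 0 (0 - Pi.single i (((1 : ℕ)) : ZMod (2 * n + 2)))‖ by field_simp]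
    exact mul_le_mul_of_nonneg_left (Complex.re_le_norm _) (mul_nonneg (pow_nonneg (Nat.cast_nonneg _) _) hZ.le)
  have h3 : (‖pairIntegral (m := m) ρ JE JM 0 (0 - Pi.single i (((2 ^ 0 : ℕ)) : ZMod (2 * n + 2)))‖ / Z) ^ (2 ^ b) ≤
      (N : ℝ) ^ (2 * 2 ^ b - 2) * (‖pairIntegral (m := m) ρ JE JM 0 (0 - Pi.single i (((2 ^ b : ℕ)) : ZMod (2 * n + 2)))‖ / Z) := by
    rw [← pow_mul, show 2 * (2 ^ b - 1) = 2 * 2 ^ b - 2 by omega] at h3'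
    simp only [he₂] at h3'
    exact h3'
  have h4' : ‖1 - ω‖ ^ 2 * (‖pairIntegral (m := m) ρ JE JM 0 (0 - Pi.single i (((2 ^ b : ℕ)) : ZMod (2 * n + 2)))‖ / Z) ^ 2 ≤
      8 * (N : ℝ) ^ 4 * (1 - R / Z) := by
    rw [div_pow, ← mul_div_assoc, div_le_iff₀ (pow_pos hZ 2)]
    have hrw : 8 * (N : ℝ) ^ 4 * (1 - R / Z) * Z ^ 2 = 8 * (N : ℝ) ^ 4 * Z * (Z - R) := by field_simp
    rw [hrw]
    exact h4
  have hA1 : 1 ≤ 2 ^ a := Nat.one_le_two_pow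
  have hB1 : 1 ≤ 2 ^ b := Nat.one_le_two_pow
  have key := ty_chain_algebra (A := 2 ^ a) (B := 2 ^ b) (Nat.cast_nonneg N) (div_nonneg (norm_nonneg _) hZ.le)
    (div_nonneg (norm_nonneg _) hZ.le) (div_nonneg (norm_nonneg _) hZ.le) (sq_nonneg _) hA1 hB1 h1 h2 h3 h4'
  have hexp1 : 2 * 2 ^ a * (2 * 2 ^ b) = (2 * m + 2) * (2 * n + 2) := by rw [← hm, ← hn]; ring
  have hexp2 : 2 * 2 ^ a * (2 * 2 ^ b) + 2 * (2 * 2 ^ b) = (2 * m + 2) * (2 * n + 2) + 2 * (2 * n + 2) := by rw [← hm, ← hn]; ring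
  rw [hexp2, hexp1, hc0] at key
  exact key

end Assembly

end FiniteTemperature

end Literature.Barriers.QuantumFields

end
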